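import Mathlib
import HarnessLib
import Summits.NavierStokesRegularity.NavierStokesRegularity.Theorems.PoloidalWindowDoorLrcModEntireRidgeWebRecurrent
import Summits.NavierStokesRegularity.NavierStokesRegularity.Theorems.PoloidalWindowDoorLrcModEntireRidgeWebTH

/-!
# Item `LrcModEntire` (stmt-NavierStokesRegularity-20428) / crux `PoloidalWindowRigidity` (19708) — THE RECURRENT (Q4) OBJECT WITH ITS (TH) STRUCTURE:
# the recurrent twin of port-2's `exists_hullLimit_ridgeWebTH` (= the hypothesis package of the v8 research cell `stub_Q4`, plus uniform recurrence)

Seat ns-poloidal-K2-p2 g15 (DIRECTOR-NS #301 (A)(1); `--supports stmt-NavierStokesRegularity-19708 --as helper`).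

* `exists_uniformlyRecurrent_ridgeWebTH` — hypotheses = port-2 g6's `…RidgeWebTH.exists_hullLimit_ridgeWebTH` (p717068) WITHOUT the base sequence: pinned peakless
  class package VERBATIM, `σ = ±1`, the complete `κ₀`-branch `γ` with normal `ν`, the GLOBAL bilinear (TH) identity (`stub_T2b` binder 3 VERBATIM), the frozen law, a
  non-flat witness.  Conclusion = ITS conclusion VERBATIM (base sequence `sq` existential, no subsequence `φ`): the hull element `U` with branch `Γ`, `ν_Γ`, `F`, `R`,
  `r`, `δ`, `m`, (Q3∞), cold lateral / hot centre, strict concavity, WEB FERMAT, the (TH) identity and frozen law for `U`, the common `C³` slope function `μ` on the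
  uniform slab for BOTH `v` and `U` — PLUS UNIFORM RECURRENCE of `(U, Γ)` under sliding along `Γ`.  So the prover of the research cell (Q4) («HOMOGENEOUS NULL RIDGE
  IN A STRICT WAVE LAYER», twist_split v8 `stub_Q4`) obtains, from the cell's own binders and by ONE call, a (Q4) object that is moreover uniformly recurrent
  (refuter1 K-343: the plug needs no text change of the cell).

PROOF: `…RidgeWebRecurrent.exists_uniformlyRecurrent_ridgeWeb` + port-2's hull-closedness of (TH) / frozen law / slope form along translation points in `P₀`
(`…RidgeHullTH.TH_of_hullLimit`, `frozenLaw_of_hullLimit`, `…TwistingTHSlopeSlab.exists_slopeFunction_slab`, `slopeForm_hullLimit_slab`) — word for word the proof of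
p717068 with the recurrent member in place of the plain hull limit (its hull witnesses `γ(sq j) ∈ P₀` are what the transport lemmas consume).

WHAT THIS IS NOT: not a claim about Navier–Stokes regularity — the (Q4) research cell is OPEN; `stub_T2b`, item 20428, crux 19708, ⟨27893⟩ OPEN; no summit statement is
proved here (bears_on LADDER-NS N0, rung N0-LocalTubeDoorPoloidal).
-/

noncomputable section

-- the summit and its single sub-problem share the name (CONVENTIONS §1), as in every Theorems file
set_option linter.dupNamespace false

namespace Summit.NavierStokesRegularity.NavierStokesRegularity.Theorems.PoloidalWindowDoorLrcModEntireRidgeWebRecurrentTH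

open Set Filter Topology Metric Function
open scoped ContDiff InnerProductSpace RealInnerProductSpace Laplacian
open Literature.Analysis Literature.Analysis.FluidPDE
open Summit.NavierStokesRegularity.NavierStokesRegularity.Theorems.PoloidalWindowDoorLrcModEntireRidgeWebRecurrent
open Summit.NavierStokesRegularity.NavierStokesRegularity.Theorems.PoloidalWindowDoorLrcModEntireRidgeHullTH
open Summit.NavierStokesRegularity.NavierStokesRegularity.Theorems.PoloidalWindowDoorLrcModEntireTwistingTHSlopeSlab

/-- **THE RECURRENT (Q4) OBJECT WITH ITS (TH) STRUCTURE.**  See the module docstring. -/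
theorem exists_uniformlyRecurrent_ridgeWebTH (C : ℝ) (v : ℝ → EuclideanSpace ℝ (Fin 3) → EuclideanSpace ℝ (Fin 3))
    (hP : (Literature.Analysis.FluidPDE.HasTypeITimeDecay C v ∧
        ContinuousOn (Function.uncurry v) (Set.Iio (0 : ℝ) ×ˢ Set.univ) ∧
        (∀ s t : ℝ, s < t → t < 0 → ∀ x, v t x =
          Literature.Analysis.UnboundedOperators.heatExtension (v s) (t - s) x -
            Literature.Analysis.FluidPDE.oseenDuhamel 1 s v v t x) ∧
        (∀ t < 0, Literature.Analysis.FluidPDE.VectorCalculus.IsDivFree (v t)) ∧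
        (∀ s < 0, ∀ q, ⟪Literature.Analysis.FluidPDE.curl (v s) q, EuclideanSpace.single 2 1⟫_ℝ = 0) ∧
        v (-1) 0 2 ≠ 0 ∧ (∀ t < 0, ∀ x, Real.sqrt (-t) * |v t x 2| ≤ |v (-1) 0 2|) ∧
        (∀ h : EuclideanSpace ℝ (Fin 3), fderiv ℝ (v (-1)) 0 h 2 = 0) ∧
        (deriv (fun s => v s 0 2) (-1) = v (-1) 0 2 / 2 ∧ v (-1) 0 2 * (Δ (fun q => v (-1) q 2)) 0 ≤ 0)))
    (hK : (∀ (s z₀ σ M : ℝ) (K O : Set (EuclideanSpace ℝ (Fin 3))), s < 0 →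
        ((σ = 1 ∨ σ = -1) ∧ IsCompact K ∧ K.Nonempty ∧ (∀ q ∈ K, q 2 = z₀ ∧ σ * v s q 2 = M) ∧
          IsOpen O ∧ K ⊆ O ∧ (∀ q ∈ O, q 2 = z₀ → σ * v s q 2 ≤ M) ∧
          (∀ q ∈ O, q 2 = z₀ → σ * v s q 2 = M → q ∈ K)) → False))
    {σ : ℝ} (hσ : σ = 1 ∨ σ = -1)
    {γ : ℝ → EuclideanSpace ℝ (Fin 3)} (hγ2 : ContDiff ℝ 2 γ) (hplane : ∀ s, γ s 2 = 0) (hunit : ∀ s, ‖deriv γ s‖ = 1)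
    (hhot : ∀ s, v (-1) (γ s) 2 = v (-1) 0 2)
    {ν : ℝ → EuclideanSpace ℝ (Fin 3)} (hν : ∀ s, ν s = WithLp.toLp 2 ![-(deriv γ s 1), deriv γ s 0, 0])
    {κ₀ : ℝ} (hκ₀ : 0 < κ₀) (hκ : ∀ s, κ₀ ≤ -(fderiv ℝ (fderiv ℝ (fun y => σ * v (-1) y 2)) (γ s) (ν s) (ν s)))
    (hTH : ∀ t < 0, ∀ x x' : EuclideanSpace ℝ (Fin 3), x 2 = x' 2 → ∀ b c : Fin 3, b ≠ 2 → c ≠ 2 →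
      fderiv ℝ (v t) x (EuclideanSpace.single 2 1) b * fderiv ℝ (v t) x' (EuclideanSpace.single c 1) 2 =
        fderiv ℝ (v t) x' (EuclideanSpace.single 2 1) c * fderiv ℝ (v t) x (EuclideanSpace.single b 1) 2)
    (hfrozen : ∀ s < 0, ∀ y, ⟪fderiv ℝ (v s) y (Literature.Analysis.FluidPDE.curl (v s) y), EuclideanSpace.single 2 1⟫_ℝ = 0)
    {y₁ : EuclideanSpace ℝ (Fin 3)} (hy₁ : y₁ 2 = 0) {c₁ : Fin 3} (hc₁ : c₁ ≠ 2)
    (hne₁ : fderiv ℝ (v (-1)) y₁ (EuclideanSpace.single c₁ 1) 2 ≠ 0) :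
    ∃ (sq : ℕ → ℝ) (U : ℝ → EuclideanSpace ℝ (Fin 3) → EuclideanSpace ℝ (Fin 3)) (Γ νΓ : ℝ → EuclideanSpace ℝ (Fin 3))
      (F : ℝ → EuclideanSpace ℝ (Fin 3) → ℝ) (R : ℝ → ℝ → ℝ) (r δ m : ℝ) (μ : ℝ → ℝ → ℝ) (ρ : ℝ),
      -- a branch-hull member of `(v, γ)` (pinned, peakless, same hot value) with its base sequence `sq`, and its branch `Γ`
      (Literature.Analysis.FluidPDE.HasTypeITimeDecay C U ∧
        ContinuousOn (Function.uncurry U) (Set.Iio (0 : ℝ) ×ˢ Set.univ) ∧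
        (∀ s t : ℝ, s < t → t < 0 → ∀ x, U t x =
          Literature.Analysis.UnboundedOperators.heatExtension (U s) (t - s) x -
            Literature.Analysis.FluidPDE.oseenDuhamel 1 s U U t x) ∧
        (∀ t < 0, Literature.Analysis.FluidPDE.VectorCalculus.IsDivFree (U t)) ∧
        (∀ s < 0, ∀ q, ⟪Literature.Analysis.FluidPDE.curl (U s) q, EuclideanSpace.single 2 1⟫_ℝ = 0) ∧
        U (-1) 0 2 ≠ 0 ∧ (∀ t < 0, ∀ x, Real.sqrt (-t) * |U t x 2| ≤ |U (-1) 0 2|) ∧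
        (∀ h : EuclideanSpace ℝ (Fin 3), fderiv ℝ (U (-1)) 0 h 2 = 0) ∧
        (deriv (fun s => U s 0 2) (-1) = U (-1) 0 2 / 2 ∧ U (-1) 0 2 * (Δ (fun q => U (-1) q 2)) 0 ≤ 0)) ∧
      (∀ (s z₀ σ M : ℝ) (K O : Set (EuclideanSpace ℝ (Fin 3))), s < 0 →
        ((σ = 1 ∨ σ = -1) ∧ IsCompact K ∧ K.Nonempty ∧ (∀ q ∈ K, q 2 = z₀ ∧ σ * U s q 2 = M) ∧
          IsOpen O ∧ K ⊆ O ∧ (∀ q ∈ O, q 2 = z₀ → σ * U s q 2 ≤ M) ∧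
          (∀ q ∈ O, q 2 = z₀ → σ * U s q 2 = M → q ∈ K)) → False) ∧
      U (-1) 0 2 = v (-1) 0 2 ∧
      (∀ t < 0, TendstoLocallyUniformly (fun j x => v t (x + γ (sq j))) (U t) atTop) ∧
      (∀ s, Tendsto (fun j => γ (sq j + s) - γ (sq j)) atTop (𝓝 (Γ s))) ∧
      -- re-entry package of the limit branch
      (∀ y ∈ {y : EuclideanSpace ℝ (Fin 3) | y 2 = 0 ∧ U (-1) y 2 = U (-1) 0 2}, fderiv ℝ (fun x => U (-1) x 2) y = 0) ∧
      ContDiff ℝ ∞ Γ ∧ Γ 0 = 0 ∧ (∀ s, Γ s 2 = 0) ∧ (∀ s, ‖deriv Γ s‖ = 1) ∧ (∀ s, U (-1) (Γ s) 2 = U (-1) 0 2) ∧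
      (∀ s, νΓ s = WithLp.toLp 2 ![-(deriv Γ s 1), deriv Γ s 0, 0]) ∧
      (∀ s, κ₀ ≤ -(fderiv ℝ (fderiv ℝ (fun y => σ * U (-1) y 2)) (Γ s) (νΓ s) (νΓ s))) ∧
      -- the signed space–time component, the homogeneous ridge height, the tube radius, the window, the level
      (F = fun τ y => σ * U (-1 + τ) y 2) ∧
      (∀ τ z, R τ z = sSup ((fun n : ℝ => F τ (Γ 0 + n • νΓ 0 + z • EuclideanSpace.single 2 (1 : ℝ))) '' Icc (-r) r)) ∧
      0 < r ∧ 0 < δ ∧ δ ≤ 1 / 4 ∧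
      -- (Q3∞): the cross-section maximum is homogeneous along `Γ`
      (∀ τ z : ℝ, |τ| < δ → |z| < δ → ∀ s : ℝ,
        sSup ((fun n : ℝ => F τ (Γ s + n • νΓ s + z • EuclideanSpace.single 2 (1 : ℝ))) '' Icc (-r) r) = R τ z) ∧
      -- cold lateral values, hot centre
      (∀ τ z : ℝ, |τ| < δ → |z| < δ → ∀ s n : ℝ, (n = r ∨ n = -r) → F τ (Γ s + n • νΓ s + z • EuclideanSpace.single 2 (1 : ℝ)) < m) ∧
      (∀ τ z : ℝ, |τ| < δ → |z| < δ → ∀ s : ℝ, m ≤ F τ (Γ s + z • EuclideanSpace.single 2 (1 : ℝ))) ∧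
      -- strict concavity of the cross-sections on the open tube
      (∀ τ z : ℝ, |τ| < δ → |z| < δ → ∀ s : ℝ, ∀ n ∈ Ioo (-r) r,
        fderiv ℝ (fderiv ℝ (F τ)) (Γ s + n • νΓ s + z • EuclideanSpace.single 2 (1 : ℝ)) (νΓ s) (νΓ s) < 0) ∧
      -- THE WEB FERMAT LAW at every cross-section
      (∀ τ₀ z₀ : ℝ, |τ₀| < δ → |z₀| < δ → ∀ s₀ : ℝ, ∃ n₀ ∈ Ioo (-r) r,
        F τ₀ (Γ s₀ + n₀ • νΓ s₀ + z₀ • EuclideanSpace.single 2 (1 : ℝ)) = R τ₀ z₀ ∧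
        (∀ n ∈ Icc (-r) r, n ≠ n₀ → F τ₀ (Γ s₀ + n • νΓ s₀ + z₀ • EuclideanSpace.single 2 (1 : ℝ)) < R τ₀ z₀) ∧
        DifferentiableAt ℝ (uncurry R) (τ₀, z₀) ∧
        fderiv ℝ (uncurry F) (τ₀, Γ s₀ + n₀ • νΓ s₀ + z₀ • EuclideanSpace.single 2 (1 : ℝ)) =
          (fderiv ℝ (uncurry R) (τ₀, z₀)).comp
            ((ContinuousLinearMap.fst ℝ ℝ (EuclideanSpace ℝ (Fin 3))).prod
              ((EuclideanSpace.proj (2 : Fin 3)).comp (ContinuousLinearMap.snd ℝ ℝ (EuclideanSpace ℝ (Fin 3)))))) ∧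
      -- (TH) STRUCTURE OF THE HULL ELEMENT: the global bilinear identity, the frozen law, and the slope function of `v` on a uniform slab — the SAME `μ` for `U`
      (∀ t < 0, ∀ x x' : EuclideanSpace ℝ (Fin 3), x 2 = x' 2 → ∀ b c : Fin 3, b ≠ 2 → c ≠ 2 →
        fderiv ℝ (U t) x (EuclideanSpace.single 2 1) b * fderiv ℝ (U t) x' (EuclideanSpace.single c 1) 2 =
          fderiv ℝ (U t) x' (EuclideanSpace.single 2 1) c * fderiv ℝ (U t) x (EuclideanSpace.single b 1) 2) ∧
      (∀ s < 0, ∀ y, ⟪fderiv ℝ (U s) y (Literature.Analysis.FluidPDE.curl (U s) y), EuclideanSpace.single 2 1⟫_ℝ = 0) ∧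
      0 < ρ ∧ ρ ≤ 1 ∧ ContDiff ℝ 3 (uncurry μ) ∧
      μ (-1) 0 = fderiv ℝ (v (-1)) y₁ (EuclideanSpace.single 2 1) c₁ / fderiv ℝ (v (-1)) y₁ (EuclideanSpace.single c₁ 1) 2 ∧
      (∀ t : ℝ, |t + 1| < ρ → ∀ x : EuclideanSpace ℝ (Fin 3), |x 2| < ρ → ∀ b : Fin 3, b ≠ 2 →
        fderiv ℝ (v t) x (EuclideanSpace.single 2 1) b = μ t (x 2) * fderiv ℝ (v t) x (EuclideanSpace.single b 1) 2) ∧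
      (∀ t : ℝ, |t + 1| < ρ → ∀ x : EuclideanSpace ℝ (Fin 3), |x 2| < ρ → ∀ b : Fin 3, b ≠ 2 →
        fderiv ℝ (U t) x (EuclideanSpace.single 2 1) b = μ t (x 2) * fderiv ℝ (U t) x (EuclideanSpace.single b 1) 2) ∧
      (∀ t₀ : ℝ, |t₀ + 1| < ρ → ∀ y₀ : EuclideanSpace ℝ (Fin 3), y₀ 2 = 0 →
        ∀ᶠ z in 𝓝 ((t₀, y₀) : ℝ × EuclideanSpace ℝ (Fin 3)), ∀ b : Fin 3, b ≠ 2 →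
          fderiv ℝ (U z.1) z.2 (EuclideanSpace.single 2 1) b = μ z.1 (z.2 2) * fderiv ℝ (U z.1) z.2 (EuclideanSpace.single b 1) 2) ∧
      -- UNIFORM RECURRENCE under sliding along the own branch
      (∀ ε : ℝ, 0 < ε → ∀ n : ℕ, ∃ L : ℝ, 0 < L ∧ ∀ a : ℝ, ∃ σ' ∈ Icc a (a + L),
        (∀ t ∈ Icc (-((n : ℝ) + 2)) (-((n : ℝ) + 2)⁻¹), ∀ x ∈ closedBall (0 : EuclideanSpace ℝ (Fin 3)) ((n : ℝ) + 2),
          dist (U t (x + Γ σ')) (U t x) < ε) ∧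
        (∀ s ∈ Icc (-((n : ℝ) + 2)) ((n : ℝ) + 2), dist (Γ (s + σ') - Γ σ') (Γ s) < ε)) := by

  have hP' := hP
  obtain ⟨hrate, hcont, hmild, hdivf, -, -, -, -, -⟩ := hP'
  obtain ⟨sq, U, Γ, νΓ, F, R, r, δ, m, hPU, hKU, hUN, hconv, hptγ, hcritU, hΓs, hΓ0, hΓplane, hΓunit, hΓhot, hνΓ, hκU, hF, hR,
    hr, hδ, hδ14, hhom, hlat, hmid, hconc, hweb, hrec⟩ :=
    exists_uniformlyRecurrent_ridgeWeb C v hP hK hσ hγ2 hplane hunit hhot hν hκ₀ hκ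
  -- the translation points lie in the thread plane
  have hy0 : ∀ j, γ (sq j) 2 = 0 := fun j => hplane _
  -- (TH) and the frozen law pass to the hull member
  have hTHU : ∀ t < 0, ∀ x x' : EuclideanSpace ℝ (Fin 3), x 2 = x' 2 → ∀ b c : Fin 3, b ≠ 2 → c ≠ 2 →
      fderiv ℝ (U t) x (EuclideanSpace.single 2 1) b * fderiv ℝ (U t) x' (EuclideanSpace.single c 1) 2 =
        fderiv ℝ (U t) x' (EuclideanSpace.single 2 1) c * fderiv ℝ (U t) x (EuclideanSpace.single b 1) 2 := fun t ht =>
    TH_of_hullLimit hrate hcont hmild hdivf ht (hTH t ht) (hconv t ht)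
  have hfrozenU : ∀ s < 0, ∀ y, ⟪fderiv ℝ (U s) y (curl (U s) y), EuclideanSpace.single 2 1⟫_ℝ = 0 := fun s hs =>
    frozenLaw_of_hullLimit hrate hcont hmild hdivf hs (hfrozen s hs) (hconv s hs)
  -- the slope function of `v` on a uniform slab, the same for `U`
  obtain ⟨μ, ρ, hρ, hμ3, hslab, -, hμ0⟩ := exists_slopeFunction_slab hrate hcont hmild hTH hy₁ hc₁ hne₁
  set ρ' : ℝ := min ρ 1 with hρ'
  have hρ'0 : 0 < ρ' := lt_min hρ one_pos
  have hρ'1 : ρ' ≤ 1 := min_le_right _ _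
  have hρ'ρ : ρ' ≤ ρ := min_le_left _ _
  have hslab' : ∀ t : ℝ, |t + 1| < ρ' → ∀ x : EuclideanSpace ℝ (Fin 3), |x 2| < ρ' → ∀ b : Fin 3, b ≠ 2 →
      fderiv ℝ (v t) x (EuclideanSpace.single 2 1) b = μ t (x 2) * fderiv ℝ (v t) x (EuclideanSpace.single b 1) 2 :=
    fun t ht x hx b hb => hslab t (lt_of_lt_of_le ht hρ'ρ) x (lt_of_lt_of_le hx hρ'ρ) b hb
  obtain ⟨hslabU, hevU⟩ := slopeForm_hullLimit_slab hrate hcont hmild hdivf hρ'1 hslab' hy0 hconv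
  exact ⟨sq, U, Γ, νΓ, F, R, r, δ, m, μ, ρ', hPU, hKU, hUN, hconv, hptγ, hcritU, hΓs, hΓ0, hΓplane, hΓunit, hΓhot, hνΓ, hκU, hF, hR,
    hr, hδ, hδ14, hhom, hlat, hmid, hconc, hweb, hTHU, hfrozenU, hρ'0, hρ'1, hμ3, hμ0, hslab', hslabU, hevU, hrec⟩

end Summit.NavierStokesRegularity.NavierStokesRegularity.Theorems.PoloidalWindowDoorLrcModEntireRidgeWebRecurrentTH

end
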